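import Mathlib
import Literature.Probability.LatticeModels.ScalingLimit3D
import Literature.Barriers.CriticalPhenomena.ScaleCovarianceNotMoebius
import Summits.CriticalPhenomena.Ising3DConformalLimit.Theses.HyperoctahedralRP

/-!
# Sketch — crux-ideate stmt-CriticalPhenomena-1982 (InversionUpgradeNormalised), ideator 3

First lemmas of the two idea cards, stated over existing declarations (they must elaborate;
proofs are not required at this stage).  Card A: `inversion-defect-involution`;
Card B: `circumsphere-robin-law`.
-/

noncomputable section

namespace Summit.CriticalPhenomena.Ising3DConformalLimit.Cruxes.InversionUpgradeNormalised.Sketch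

open Literature.Probability.LatticeModels EuclideanGeometry

local notation "E3" => EuclideanSpace ℝ (Fin 3)

local notation "ι" => (EuclideanGeometry.inversion (0 : EuclideanSpace ℝ (Fin 3)) (1 : ℝ))

/-! ### Elementary facts about the unit inversion -/

theorem ι_eq (x : E3) : ι x = (1 / ‖x‖) ^ 2 • x := by
  rw [inversion, dist_eq_norm, vsub_eq_sub, sub_zero, vadd_eq_add, add_zero]

theorem ι_smul {c : ℝ} (hc : 0 < c) (x : E3) : ι (c • x) = c⁻¹ • ι x := by
  rw [ι_eq, ι_eq, norm_smul, Real.norm_of_nonneg hc.le, smul_smul, smul_smul]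
  by_cases hx : x = 0
  · simp [hx]
  · congr 1
    have hxn : ‖x‖ ≠ 0 := norm_ne_zero_iff.mpr hx
    field_simp

theorem norm_ι (x : E3) : ‖ι x‖ = ‖x‖⁻¹ := by
  have h := dist_inversion_center (0 : E3) x (1 : ℝ)
  rw [dist_eq_norm, dist_eq_norm, sub_zero, sub_zero, one_pow, one_div] at h
  exact h

theorem ι_ne_zero {x : E3} (hx : x ≠ 0) : ι x ≠ 0 := by
  rwa [Ne, inversion_eq_center one_ne_zero]


/-! ## Card A — the inversion defect is ι-odd and scale-homogeneous -/

/-- ONE-SIDED inversion inequality on configurations inside the closed unit ball (avoiding 0):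
`S n (ι x) ≤ (∏ ‖x i‖^(2Δ)) · S n x`.  ("Inversion does not raise weighted correlations.") -/
def OneSidedInversion (Δ : ℝ) (S : CorrFamily 3) : Prop :=
  ∀ n (x : Fin n → E3), (∀ i, x i ≠ 0) → (∀ i, ‖x i‖ ≤ 1) →
    S n (fun i => ι (x i)) ≤ (∏ i, ‖x i‖ ^ (2 * Δ)) * S n x

/-- FIRST LEMMA (Card A).  For a scale-covariant family the one-sided inequality on the ball is
EQUIVALENT to full inversion covariance: scale the configuration into the ball (the defect
ratio is dilation invariant), then apply the inequality to `ι x` (the defect is ι-odd). No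
positivity of `S`, no rotation or translation invariance is needed. -/
def FirstLemmaA : Prop :=
  ∀ (Δ : ℝ) (S : CorrFamily 3), IsScaleCovariant Δ S →
    (OneSidedInversion Δ S ↔ IsInversionCovariant Δ S)

/-- Step 1: scale covariance spreads the inequality from the ball to every configuration. -/
theorem oneSided_everywhere {Δ : ℝ} {S : CorrFamily 3} (hsc : IsScaleCovariant Δ S)
    (h : OneSidedInversion Δ S) :
    ∀ n (y : Fin n → E3), (∀ i, y i ≠ 0) →
      S n (fun i => ι (y i)) ≤ (∏ i, ‖y i‖ ^ (2 * Δ)) * S n y := by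
  intro n y hy0
  -- the scaling factor
  set L : ℝ := 1 + ∑ i, ‖y i‖ with hL
  have hLpos : 0 < L := by
    have : 0 ≤ ∑ i, ‖y i‖ := Finset.sum_nonneg fun i _ => norm_nonneg _
    linarith
  set l : ℝ := L⁻¹ with hl
  have hlpos : 0 < l := inv_pos.mpr hLpos
  have hly : ∀ i, ‖l • y i‖ ≤ 1 := by
    intro i
    rw [norm_smul, Real.norm_of_nonneg hlpos.le, hl]
    have hi : ‖y i‖ ≤ ∑ j, ‖y j‖ :=
      Finset.single_le_sum (f := fun j => ‖y j‖) (fun _ _ => norm_nonneg _) (Finset.mem_univ i)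
    rw [inv_mul_le_iff₀ hLpos]
    linarith
  have hly0 : ∀ i, l • y i ≠ 0 := fun i => smul_ne_zero hlpos.ne' (hy0 i)
  have key := h n (fun i => l • y i) hly0 hly
  -- rewrite the left-hand side
  have lhs : S n (fun i => ι (l • y i)) = l ^ ((n : ℝ) * Δ) * S n (fun i => ι (y i)) := by
    have h1 : (fun i => ι (l • y i)) = fun i => l⁻¹ • ι (y i) := by
      funext i; exact ι_smul hlpos (y i)
    rw [h1, hsc n l⁻¹ (inv_pos.mpr hlpos)]
    congr 1
    rw [Real.inv_rpow hlpos.le, neg_mul, Real.rpow_neg hlpos.le, inv_inv]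
  -- rewrite the right-hand side
  have rhs : (∏ i, ‖l • y i‖ ^ (2 * Δ)) * S n (fun i => l • y i)
      = l ^ ((n : ℝ) * Δ) * ((∏ i, ‖y i‖ ^ (2 * Δ)) * S n y) := by
    have h2 : (∏ i, ‖l • y i‖ ^ (2 * Δ)) = l ^ ((2 * Δ) * (n : ℕ)) * ∏ i, ‖y i‖ ^ (2 * Δ) := by
      have : ∀ i, ‖l • y i‖ ^ (2 * Δ) = l ^ (2 * Δ) * ‖y i‖ ^ (2 * Δ) := by
        intro i
        rw [norm_smul, Real.norm_of_nonneg hlpos.le, Real.mul_rpow hlpos.le (norm_nonneg _)]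
      rw [Finset.prod_congr rfl fun i _ => this i, Finset.prod_mul_distrib, Finset.prod_const,
        Finset.card_univ, Fintype.card_fin, Real.rpow_mul_natCast hlpos.le]
    rw [h2, hsc n l hlpos]
    have h3 : l ^ ((2 * Δ) * (n : ℕ)) * l ^ (-(n : ℝ) * Δ) = l ^ ((n : ℝ) * Δ) := by
      rw [← Real.rpow_add hlpos]
      congr 1
      ring
    calc l ^ ((2 * Δ) * (n : ℕ)) * (∏ i, ‖y i‖ ^ (2 * Δ)) * (l ^ (-(n : ℝ) * Δ) * S n y)
        = (l ^ ((2 * Δ) * (n : ℕ)) * l ^ (-(n : ℝ) * Δ)) * ((∏ i, ‖y i‖ ^ (2 * Δ)) * S n y) := by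
          ring
      _ = l ^ ((n : ℝ) * Δ) * ((∏ i, ‖y i‖ ^ (2 * Δ)) * S n y) := by rw [h3]
  rw [lhs, rhs] at key
  exact le_of_mul_le_mul_left key (Real.rpow_pos_of_pos hlpos _)

/-- FIRST LEMMA (Card A): for a scale-covariant family, the one-sided inequality on the ball is
equivalent to inversion covariance (the defect is ι-odd and dilation-homogeneous). -/
theorem oneSidedInversion_iff {Δ : ℝ} {S : CorrFamily 3} (hsc : IsScaleCovariant Δ S) :
    OneSidedInversion Δ S ↔ IsInversionCovariant Δ S := by
  constructor
  · intro h n x hx0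
    have h1 := oneSided_everywhere hsc h n x hx0
    have h2 := oneSided_everywhere hsc h n (fun i => ι (x i)) (fun i => ι_ne_zero (hx0 i))
    have hιι : (fun i => ι (ι (x i))) = x := by
      funext i; exact inversion_inversion (0 : E3) one_ne_zero (x i)
    have hP : (∏ i, ‖ι (x i)‖ ^ (2 * Δ)) = (∏ i, ‖x i‖ ^ (2 * Δ))⁻¹ := by
      rw [← Finset.prod_inv_distrib]
      refine Finset.prod_congr rfl fun i _ => ?_
      rw [norm_ι (x i), Real.inv_rpow (norm_nonneg _)]
    rw [hιι, hP] at h2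
    have hPpos : 0 < ∏ i, ‖x i‖ ^ (2 * Δ) :=
      Finset.prod_pos fun i _ => Real.rpow_pos_of_pos (norm_pos_iff.mpr (hx0 i)) _
    have h3 : (∏ i, ‖x i‖ ^ (2 * Δ)) * S n x ≤ S n (fun i => ι (x i)) := by
      have := mul_le_mul_of_nonneg_left h2 hPpos.le
      rwa [← mul_assoc, mul_inv_cancel₀ hPpos.ne', one_mul] at this
    exact le_antisymm h1 h3
  · intro hcov n x hx0 _
    exact (hcov n x hx0).le


/-- FirstLemmaA is a THEOREM (sorry-free, standard axioms). -/
theorem firstLemmaA_holds : FirstLemmaA := fun _ _ hsc => oneSidedInversion_iff hsc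


/-- The n = 4 content of the one-sided inequality: since the Wick part is exactly covariant
(`ScaleNotMoebius.wick_inversion` pattern, with `S 2` a pure power by Euclid + scale), only the
Lebowitz-signed connected part enters:  `U₄(ι x) ≤ (∏‖x i‖^(2Δ)) U₄(x)` inside the ball, i.e.
`|U₄|` does not DEcrease under weighted inversion; in random-current form the double-current
intersection probability of the four sources does not decrease under inversion. -/
def FourPointOneSided (Δ : ℝ) (S : CorrFamily 3) : Prop :=
  ∀ (x : Fin 4 → E3), (∀ i, x i ≠ 0) → (∀ i, ‖x i‖ ≤ 1) → Function.Injective x →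
    limitConnectedFour S (fun i => ι (x i)) ≤ (∏ i, ‖x i‖ ^ (2 * Δ)) * limitConnectedFour S x

/-- Support (provable now): Euclid + scale force `S 2` to be a pure power, hence inversion
covariant at n = 2; consequently the Wick part of `S 4` is inversion covariant. -/
def TwoPointInversionCovariant : Prop :=
  ∀ (Δ : ℝ) (S : CorrFamily 3), IsEuclideanInvariant S → IsScaleCovariant Δ S →
    ∀ (x y : E3), x ≠ 0 → y ≠ 0 → x ≠ y →
      S 2 ![ι x, ι y] = ‖x‖ ^ (2 * Δ) * ‖y‖ ^ (2 * Δ) * S 2 ![x, y]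

/-- The crux-level statement Card A proposes to staff (equivalent to the crux by FirstLemmaA):
the normalised critical Ising limit satisfies the one-sided inequality. -/
def CriticalOneSidedInversion : Prop :=
  ∀ (ρ : ℝ → ℝ) (Δ : ℝ) (S : CorrFamily 3), (∀ δ ∈ Set.Ioc (0:ℝ) 1, 0 < ρ δ) →
    HasPointwiseScalingLimit (criticalCorr 3) ρ S →
    (∀ n z, z ∉ NonCoincident 3 n → S n z = 0) → IsNondegenerateTwoPoint S →
    IsEuclideanInvariant S → IsScaleCovariant Δ S → OneSidedInversion Δ S

/-- Card A closes the crux: the one-sided inequality for the critical limit IS the crux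
(kernel-checked reduction, using the proved `oneSidedInversion_iff`). -/
theorem cardA_closes (h : CriticalOneSidedInversion) :
    Theses.HyperoctahedralRP.InversionUpgradeNormalised := by
  intro ρ Δ S hρ hlim hnorm hnd heuc hsc
  exact (oneSidedInversion_iff hsc).1 (h ρ Δ S hρ hlim hnorm hnd heuc hsc)

/-- Conversely the crux gives the one-sided inequality (so Card A's target is EQUIVALENT to the
crux, not a strengthening). -/
theorem cardA_of_crux (h : Theses.HyperoctahedralRP.InversionUpgradeNormalised) :
    CriticalOneSidedInversion := by
  intro ρ Δ S hρ hlim hnorm hnd heuc hsc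
  exact (oneSidedInversion_iff hsc).2 (h ρ Δ S hρ hlim hnorm hnd heuc hsc)

/-! ## Card B — every four points are co-spherical: the circumsphere Robin law -/

/-- CIRCUMSPHERE ROBIN LAW at n = 4: if the four points lie on the sphere of centre `c` and radius
`R`, then moving ONE point radially away from `c` the four-point function decays locally with the
pure power `Δ`:  d/dt S₄(…, c + eᵗ(xᵢ − c), …)|ₜ₌₀ = −Δ · S₄(x).  (Inversion in the circumsphere
fixes the configuration; this is its first-order shadow, the spherical analogue of the Neumann
law ∂ₙS = 0 on mirror planes.) -/
def CircumsphereRobinLaw (Δ : ℝ) (S : CorrFamily 3) : Prop :=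
  ∀ (x : Fin 4 → E3) (c : E3) (R : ℝ), 0 < R → Function.Injective x →
    (∀ i, dist (x i) c = R) →
    ∀ i : Fin 4, HasDerivAt (fun t : ℝ => S 4 (Function.update x i (c + Real.exp t • (x i - c))))
      (-Δ * S 4 x) 0

/-- Inversion covariance of the four-point function alone. -/
def FourPointInversionCovariant (Δ : ℝ) (S : CorrFamily 3) : Prop :=
  ∀ (x : Fin 4 → E3), (∀ i, x i ≠ 0) →
    S 4 (fun i => ι (x i)) = (∏ i, ‖x i‖ ^ (2 * Δ)) * S 4 x

/-- FIRST LEMMA (Card B).  For a C¹, Euclidean-invariant, scale-covariant family the Robin law at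
every 4-point configuration (w.r.t. its own circumsphere) is EQUIVALENT to Möbius (inversion)
covariance of `S 4`: at a co-spherical configuration the special conformal generator centred at
the circumcentre is `K_b^{(c)} = 2 Σᵢ (b·(xᵢ−c)) · Robinᵢ − R² (b·P)`, so Robin + translations
kill every `K_b`; conversely covariance under the inversion in the circumsphere differentiates to
Robin. -/
def FirstLemmaB : Prop :=
  ∀ (Δ : ℝ) (S : CorrFamily 3), IsEuclideanInvariant S → IsScaleCovariant Δ S →
    ContDiffOn ℝ 1 (S 4) (NonCoincident 3 4) →
    (∀ z, z ∉ NonCoincident 3 4 → S 4 z = 0) →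
    (CircumsphereRobinLaw Δ S ↔ FourPointInversionCovariant Δ S)

/-- The unit normal `e₃` of the lattice mirror plane `{x₃ = 0}`. -/
def e3 : E3 := EuclideanSpace.single (2 : Fin 3) (1 : ℝ)

/-- Mixed second NORMAL derivative of `S n` at a configuration `x`, displacing points `i` and `j`
off the mirror plane along `e₃`. -/
def normalHessian (S : CorrFamily 3) (n : ℕ) (x : Fin n → E3) (i j : Fin n) : ℝ :=
  deriv (fun s : ℝ => deriv (fun t : ℝ =>
    S n (Function.update (Function.update x i (x i + t • e3)) j
      ((Function.update x i (x i + t • e3)) j + s • e3))) 0) 0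

/-- In-plane radial first derivative of `S n` at point `j` about an origin `o`:
d/dt S n (…, x j + t (x j − o), …)|ₜ₌₀ = (x j − o)·∇ⱼ S n. -/
def radialDeriv (S : CorrFamily 3) (n : ℕ) (x : Fin n → E3) (o : E3) (j : Fin n) : ℝ :=
  deriv (fun t : ℝ => S n (Function.update x j (x j + t • (x j - o)))) 0

/-- MIRROR IDENTITY (first genuinely conformal member of the curvature tower at a lattice mirror
plane; derived by expanding covariance under the inversions in the spheres of radius `a` tangent
to the plane at `o`, to order a⁻²): for COPLANAR configurations in `{x₃ = 0}` and every origin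
`o` in that plane, with `A j = ‖x j − o‖²`,
  ½ Σⱼ Σₖ A j · A k · ∂⊥ⱼ∂⊥ₖ S n (x) = Σⱼ A j · ((x j − o)·∇ⱼ S n (x) + Δ · S n x).
Checked by hand at n = 2 (pure power) and on Wick products; the o-linear and o-quadratic parts of
the same expansion are the in-plane special-conformal and rotation Ward identities. For the
Möbius-INVARIANT random-current ratio p the same identity holds with Δ = 0 (Δ-free test). -/
def MirrorIdentity (Δ : ℝ) (S : CorrFamily 3) : Prop :=
  ∀ n (x : Fin n → E3) (o : E3), Function.Injective x → (∀ i, inner ℝ (x i) e3 = 0) →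
    inner ℝ o e3 = 0 →
    (1 / 2) * ∑ j, ∑ k, ‖x j - o‖ ^ 2 * ‖x k - o‖ ^ 2 * normalHessian S n x j k
      = ∑ j, ‖x j - o‖ ^ 2 * (radialDeriv S n x o j + Δ * S n x)

/-- The crux-level statement Card B proposes to staff first (n = 4 milestone): the normalised
critical Ising limit obeys the circumsphere Robin law. -/
def CriticalRobinLaw : Prop :=
  ∀ (ρ : ℝ → ℝ) (Δ : ℝ) (S : CorrFamily 3), (∀ δ ∈ Set.Ioc (0:ℝ) 1, 0 < ρ δ) →
    HasPointwiseScalingLimit (criticalCorr 3) ρ S →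
    (∀ n z, z ∉ NonCoincident 3 n → S n z = 0) → IsNondegenerateTwoPoint S →
    IsEuclideanInvariant S → IsScaleCovariant Δ S → CircumsphereRobinLaw Δ S

end Summit.CriticalPhenomena.Ising3DConformalLimit.Cruxes.InversionUpgradeNormalised.Sketch

end
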